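import Summits.QuantumFields.BalabanUV.Beta.GAN24.WilsonEdgeCurrentDivFree
import Summits.QuantumFields.BalabanUV.Beta.GAN24.WilsonVertexSumZero

/-!
# `BalabanUV.Beta.GAN24.WilsonCurrentBoxForm` — binder row G-an2-4 ∕ (CONV-C), W-slot CT-W, conservation law (C)∕(C)sym, adapter (R2) of this lineage's note
# `HOME/b2b-balaban-gan24-formalise-leaf-04/g68/EXIT-FACE-CURRENT-TOWER.md` §7: **THE `tsum`-FORM WILSON HYPOTHESIS `hW` OF THE (D)-TOWER (`ExitFaceCurrentTower`) FROM T0** — the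
# class-weighted two-leg current of an3's bare Wilson cubic table `Σ'_q h(q_β)·Σ'_u s(u_ν)·wilsonA d ν u v q (inl κ′)(inl β)` is, by the finite support of the table (legs in the box
# `u + {−1,0,1}^{d+1}`) and its ff antisymmetry, MINUS T0's finite bi-weighted box current at `z = v`; so T0 `WilsonEdgeCurrentDivFree.sum_wilsonA_biweighted_divFree_all` gives `hW` for ALL
# single-coordinate profile weights.

NOT IN PRINT; OUR BOOKKEEPING ([folklore] finite-support bookkeeping BY NAME over leaf-18∕leaf-02's `WilsonVertexSumZero` (`wEntry_eq_zero_of_row ∕ _of_col`, `row_mem_suppW ∕ col_mem_suppW`,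
`suppW_subset_box`), an3's `StepJetData.wilsonA_antisymm`, and T0; G-an2-4 formalisation swarm, leaf prover `b2b-balaban-gan24-formalise-leaf-04`, gen 68).  HONEST FRAMING (cell contract,
verbatim): «discharging `BetaPertH` makes Bałaban's UV stability UNCONDITIONAL — a real constructive-QFT result; it is NOT the continuum limit and NOT the Clay problem.»  HONEST DEPENDENCY
(verbatim): «continuum YM on T⁴ ⇐ BetaPertH ∧ nine spine estimates (0/9 proved); BetaPertH ⇐ (D1) ∧ (D4) ∧ CAP+tail; G-an2-4 gates asym, D1 and NE2/3/4.»

WHAT ([folklore]; generic `d`; 0 `def`, 0 cited facts, 0 `def … : Prop`, 0 sorry): §1 `wilsonA_inl_inl_eq_zero_of_not_mem_left ∕ _right` (box support of both legs); §2 `tsum_slot_wilsonA_eq_sum`,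
`tsum_leg_slot_wilsonA_eq_sum` (the `tsum` current as T0's box current, sign flipped); §3 **`divFree_wilson_current`** — `hW` of `ExitFaceCurrentTower` for arbitrary profile weights
`h(q_β)`, `s(u_ν)` (`h s : ℤ → ℝ`).  Asserts NO value of Bałaban's tables beyond an3's DEFINED stencil; discharges NOTHING of (C)sym ∕ (Q-D) ∕ (Q-D-rate) ∕ «T2Shape» ∕ «T2Drift» ∕ (hW, hWall);
NEVER «G-an2-4 closed» as (CONV-C); NOT D1, NOT `BetaPertH`, NOT continuum, NOT Clay.  2026-08-23; no existing file touched.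
-/

noncomputable section

open Finset
open scoped BigOperators
open Literature.MathematicalPhysics.QuantumFieldTheory
open Literature.MathematicalPhysics.QuantumFieldTheory.Balaban1983to89
open Literature.MathematicalPhysics.QuantumFieldTheory.Balaban1983to89.Beta
open ExpKernelCalculus (Site)
open StepJetData (wEntry wilsonA wilsonA_antisymm)
open BalabanStepJets (box1 mem_box1)
open OneStepResolventKernel (Fib)
open Summit.QuantumFields.BalabanUV.Beta.GAN24.WilsonVertexSumZero (uv wEntry_eq_zero_of_row wEntry_eq_zero_of_col row_mem_suppW col_mem_suppW suppW_subset_box)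
open Summit.QuantumFields.BalabanUV.Beta.GAN24.WilsonEdgeCurrentDivFree (sum_wilsonA_biweighted_divFree_all)

namespace Summit.QuantumFields.BalabanUV.Beta.GAN24.WilsonCurrentBoxForm

variable {d : ℕ}

/-! ## §1 Box support of both legs -/

/-- [folklore] An entry with its ROW outside the box `u + {−1,0,1}^{d+1}` vanishes. -/
theorem wEntry_eq_zero_of_not_mem_row (κ' : Fin (d + 1)) (u x z : Site (d + 1)) (α β : Fin (d + 1)) (hx : x ∉ (box1 (d + 1)).image (fun v => u + v)) :
    wEntry d κ' u x z α β = 0 :=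
  wEntry_eq_zero_of_row κ' u x z α β fun i h => hx (h ▸ suppW_subset_box κ' u (row_mem_suppW κ' u i))

/-- [folklore] An entry with its COLUMN outside the box vanishes. -/
theorem wEntry_eq_zero_of_not_mem_col (κ' : Fin (d + 1)) (u x z : Site (d + 1)) (α β : Fin (d + 1)) (hz : z ∉ (box1 (d + 1)).image (fun v => u + v)) :
    wEntry d κ' u x z α β = 0 :=
  wEntry_eq_zero_of_col κ' u x z α β fun i h => hz (h ▸ suppW_subset_box κ' u (col_mem_suppW κ' u i))

/-- [folklore] **BOX SUPPORT OF THE FIRST LEG** of an3's antisymmetrised Wilson table. -/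
theorem wilsonA_inl_inl_eq_zero_of_not_mem_left (κ' : Fin (d + 1)) (u x z : Site (d + 1)) (α β : Fin (d + 1)) (hx : x ∉ (box1 (d + 1)).image (fun v => u + v)) :
    wilsonA d κ' u x z (Sum.inl α) (Sum.inl β) = 0 := by
  show (1 / 2 : ℝ) * (wEntry d κ' u x z α β - wEntry d κ' u z x β α) = 0
  rw [wEntry_eq_zero_of_not_mem_row κ' u x z α β hx, wEntry_eq_zero_of_not_mem_col κ' u z x β α hx, sub_zero, mul_zero]

/-- [folklore] **BOX SUPPORT OF THE SECOND LEG**. -/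
theorem wilsonA_inl_inl_eq_zero_of_not_mem_right (κ' : Fin (d + 1)) (u x z : Site (d + 1)) (α β : Fin (d + 1)) (hz : z ∉ (box1 (d + 1)).image (fun v => u + v)) :
    wilsonA d κ' u x z (Sum.inl α) (Sum.inl β) = 0 := by
  show (1 / 2 : ℝ) * (wEntry d κ' u x z α β - wEntry d κ' u z x β α) = 0
  rw [wEntry_eq_zero_of_not_mem_col κ' u x z α β hz, wEntry_eq_zero_of_not_mem_row κ' u z x β α hz, sub_zero, mul_zero]

/-! ## §2 The `tsum` current as a box current -/

/-- [folklore] The slot sum is a box sum: `Σ'_u s u·W ν u v q = Σ_{w ∈ box1} s (v − w)·W ν (v − w) v q` (first leg `v` in the box of the slot). -/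
theorem tsum_slot_wilsonA_eq_sum (ν : Fin (d + 1)) (s : Site (d + 1) → ℝ) (v q : Site (d + 1)) (a b : Fin (d + 1)) :
    ∑' u : Site (d + 1), s u * wilsonA d ν u v q (Sum.inl a) (Sum.inl b) =
      ∑ w ∈ box1 (d + 1), s (v - w) * wilsonA d ν (v - w) v q (Sum.inl a) (Sum.inl b) := by
  classical
  have hinj : Set.InjOn (fun w : Site (d + 1) => v - w) (box1 (d + 1) : Set (Site (d + 1))) := fun w _ w' _ h => by simpa using h
  rw [tsum_eq_sum (s := (box1 (d + 1)).image (fun w => v - w)) (fun u hu => ?_), Finset.sum_image hinj]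
  have hv : v ∉ (box1 (d + 1)).image (fun w => u + w) := by
    intro h
    obtain ⟨w, hw, hwv⟩ := Finset.mem_image.1 h
    exact hu (Finset.mem_image.2 ⟨w, hw, by rw [← hwv]; abel⟩)
  rw [wilsonA_inl_inl_eq_zero_of_not_mem_left ν u v q a b hv, mul_zero]

/-- [folklore] The two-leg current is a double box sum: `Σ'_q h q·Σ'_u s u·W ν u v q = Σ_{x ∈ box1} Σ_{w ∈ box1} h (v − w + x)·s (v − w)·W ν (v − w) v (v − w + x)`. -/
theorem tsum_leg_slot_wilsonA_eq_sum (ν : Fin (d + 1)) (h s : Site (d + 1) → ℝ) (v : Site (d + 1)) (a b : Fin (d + 1)) :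
    ∑' q : Site (d + 1), h q * ∑' u : Site (d + 1), s u * wilsonA d ν u v q (Sum.inl a) (Sum.inl b) =
      ∑ x ∈ box1 (d + 1), ∑ w ∈ box1 (d + 1), h (v - w + x) * s (v - w) * wilsonA d ν (v - w) v (v - w + x) (Sum.inl a) (Sum.inl b) := by
  classical
  simp only [tsum_slot_wilsonA_eq_sum]
  -- the `q`-sum is finite: support inside `S = {v − w + x}`
  set S : Finset (Site (d + 1)) := ((box1 (d + 1)) ×ˢ (box1 (d + 1))).image (fun wx => v - wx.1 + wx.2) with hS
  have hsupp : ∀ q : Site (d + 1), q ∉ S → h q * ∑ w ∈ box1 (d + 1), s (v - w) * wilsonA d ν (v - w) v q (Sum.inl a) (Sum.inl b) = 0 := by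
    intro q hq
    rw [Finset.sum_eq_zero (fun w hw => ?_), mul_zero]
    have hq' : q ∉ (box1 (d + 1)).image (fun x => (v - w) + x) := by
      intro h'
      obtain ⟨x, hx, hxq⟩ := Finset.mem_image.1 h'
      exact hq (Finset.mem_image.2 ⟨(w, x), Finset.mem_product.2 ⟨hw, hx⟩, hxq⟩)
    rw [wilsonA_inl_inl_eq_zero_of_not_mem_right ν (v - w) v q a b hq', mul_zero]
  rw [tsum_eq_sum (s := S) hsupp, Finset.sum_comm]
  -- per `w`, the `q`-sum over `S` is the `x`-sum over the box
  simp only [Finset.mul_sum]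
  rw [Finset.sum_comm]
  refine Finset.sum_congr rfl fun w hw => ?_
  have hinj : Set.InjOn (fun x : Site (d + 1) => v - w + x) (box1 (d + 1) : Set (Site (d + 1))) := fun x _ x' _ h => by simpa using h
  have hsub : (box1 (d + 1)).image (fun x => v - w + x) ⊆ S := by
    intro q hq
    obtain ⟨x, hx, hxq⟩ := Finset.mem_image.1 hq
    exact Finset.mem_image.2 ⟨(w, x), Finset.mem_product.2 ⟨hw, hx⟩, hxq⟩
  rw [← Finset.sum_subset hsub (fun q _ hq => ?_), Finset.sum_image hinj]
  · exact Finset.sum_congr rfl fun x _ => by ring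
  · rw [wilsonA_inl_inl_eq_zero_of_not_mem_right ν (v - w) v q a b hq, mul_zero, mul_zero]

/-! ## §3 The Wilson hypothesis of the tower -/

/-- [folklore] **`hW` OF `ExitFaceCurrentTower` FROM T0**: for ALL single-coordinate profile weights `h(q_β)`, `s(u_ν)` and every `v`,
`Σ_κ′ ((Σ'_q h(q_β)·Σ'_u s(u_ν)·wilsonA d ν u v q (inl κ′)(inl β)) − (same at v − e_κ′)) = 0`. -/
theorem divFree_wilson_current (ν β : Fin (d + 1)) (hf sf : ℤ → ℝ) (v : Site (d + 1)) :
    ∑ κ' : Fin (d + 1),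
      ((∑' q : Site (d + 1), hf (q β) * ∑' u : Site (d + 1), sf (u ν) * wilsonA d ν u v q (Sum.inl κ') (Sum.inl β))
        - ∑' q : Site (d + 1), hf (q β) * ∑' u : Site (d + 1), sf (u ν) * wilsonA d ν u (v - B6BondElimination.unitVec κ') q (Sum.inl κ') (Sum.inl β)) = 0 := by
  have hUV : ∀ κ' : Fin (d + 1), (B6BondElimination.unitVec κ' : Site (d + 1)) = AffineAveraging.unitVec κ' := fun κ' =>
    funext fun l => by simp [B6BondElimination.unitVec_apply, AffineAveraging.unitVec_apply]
  have key := sum_wilsonA_biweighted_divFree_all (d := d) ν β sf hf v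
  simp only [tsum_leg_slot_wilsonA_eq_sum ν (fun q => hf (q β)) (fun u => sf (u ν)), hUV]
  -- flip the two legs (ff antisymmetry) to T0's orientation
  have flip : ∀ (u x z : Site (d + 1)) (κ' : Fin (d + 1)), wilsonA d ν u z x (Sum.inl κ') (Sum.inl β) = -wilsonA d ν u x z (Sum.inl β) (Sum.inl κ') :=
    fun u x z κ' => wilsonA_antisymm ν u x z (Sum.inl β) (Sum.inl κ')
  simp only [flip, mul_neg, Finset.sum_neg_distrib, neg_sub_neg]
  rw [← neg_eq_zero, ← key, ← Finset.sum_neg_distrib]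
  refine Finset.sum_congr rfl fun κ' _ => ?_
  rw [neg_sub]
  congr 1 <;> exact Finset.sum_congr rfl fun x _ => Finset.sum_congr rfl fun w _ => by ring

end Summit.QuantumFields.BalabanUV.Beta.GAN24.WilsonCurrentBoxForm
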